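import Summits.Ventures.HodgeRepro.CyclicDichotomy
import Summits.Ventures.HodgeRepro.SingleClass

/-!
# Cyclic Galois CM fields of degree `2pq` (two odd primes): no single-class `SumTwo` quadruple without a conjugate pair

Blind re-derivation cell `pub-hodge-repro`, seat `p1` (gen 8).  `CyclicPrimePowerNoSingleClass.lean` settles the cyclic
groups of order `2 · 2^a q^b`; `SingleClass60Witness.lean` shows that with two odd primes an instance exists as soon as
`m/(pq) ≥ 2`.  This file settles the remaining squarefree-odd case `m = pq`:

**Theorem** (`exists_conj_of_sumTwo_cyclic_two_primes`, `not_isSingleClass_cyclic_two_primes`).  On `ℤ/N`, `N = 2pq`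
with `p ≠ q` odd primes, `c = pq`: every `SumTwo` quadruple of Galois twists of a CM type has two complex-conjugate
corners — `C₃₀, C₄₂, C₆₆, C₇₀, C₇₈, C₁₀₂, …` carry no single-class exceptional Pohlmann `4`-set in codimension `2`
(instances `not_isSingleClass_C{30,42,66,70,78}_cyclic`).  Together with the one-prime theorem and the degree-60 witness:
a cyclic `(ℤ/2m, m)` has such a quadruple only if `m` has two odd prime factors and `m ≠ pq`.

Proof (`ψ = ZMod.stdAddChar`, `f = 1_Φ`, `Δ̂(k) = ∑ᵢ ψ(−gᵢ k)`; `SumTwo` gives `Δ̂(k) · 𝓕f(k) = 0` for `k ≠ 0`):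
1. **Support** (`support`): `𝓕f(k) = 0` for even `k` (CM condition) and for `k` coprime to `N` (four roots + lifting with
   the trivial period: a vanishing `Δ̂(k)` would give a conjugate pair); so `𝓕f` lives on `{0} ∪ pℤ ∪ qℤ`.
2. **Dichotomy** (`CyclicDichotomy.periodic_dichotomy` via the rectangle identity): `f` is `2p`- or `2q`-periodic.
3. **Branch** (`branch`): if `f` is `2p`-periodic, either some `ψ(q (g₀ − gⱼ)) = −1` (lifting with period `2p` gives
   `Φ gⱼ = c • Φ g₀`), or every `𝓕f(k)` with `q ∣ k`, `p ∤ k` vanishes, so `𝓕f` lives on `{0, pq}`, `f` is `2`-periodic,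
   `𝓕f(pq) ≠ 0` (else `f` is constant, impossible for a CM type), `Δ̂(pq) = 0`, and the lifting with period `2` gives a
   conjugate pair.  The `2q`-periodic case is the same with `p ↔ q`.
-/

set_option autoImplicit false

open Finset AddChar ZMod
open scoped Pointwise

namespace HodgeRepro.CyclicQuad

variable {N : ℕ} [NeZero N]

/-- If `N = a b` and `a k = 0` in `ℤ/N` then `b ∣ k.val`. -/
theorem dvd_val_of_mul_eq_zero {a b : ℕ} (hN : N = a * b) (ha : 0 < a) (k : ZMod N)
    (h : (a : ZMod N) * k = 0) : b ∣ k.val := by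
  have hw : ((a * k.val : ℕ) : ZMod N) = 0 := by rw [Nat.cast_mul, ZMod.natCast_zmod_val]; exact h
  rw [ZMod.natCast_eq_zero_iff] at hw
  have hw2 : a * b ∣ a * k.val := by rw [← hN]; exact hw
  exact Nat.dvd_of_mul_dvd_mul_left ha hw2

/-- A `P`-periodic function has `𝓕f` supported on `{k : P k = 0}`. -/
theorem mul_eq_zero_of_dft_ne_zero_of_periodic (f : ZMod N → ℂ) (P : ZMod N)
    (hper : ∀ x, f (x + P) = f x) (k : ZMod N) (hk : ZMod.dft f k ≠ 0) : P * k = 0 := by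
  have h := dft_shift f (-P) k
  have e : (fun x => f (x - -P)) = f := by funext x; rw [sub_neg_eq_add, hper]
  rw [e, neg_mul, neg_neg] at h
  have h2 : (stdAddChar (P * k) - 1) * ZMod.dft f k = 0 := by linear_combination -h
  have h3 : stdAddChar (P * k) = 1 := sub_eq_zero.mp ((mul_eq_zero.mp h2).resolve_right hk)
  exact injective_stdAddChar (h3.trans (map_zero_eq_one _).symm)

/-- A conjugate pair from a character value `ψ(g k' (g₀ − gⱼ)) = -1` and a period `P` (`N = g P`). -/
theorem conj_of_char {m : ℕ} (g P k' : ℕ) (hN : N = 2 * m) (hgm : g ∣ m) (hP : N = g * P) (hP2 : 2 ∣ P)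
    (hg : Odd g) (hk' : Nat.Coprime k' P) (Φ : Finset (Multiplicative (ZMod N))) (gA : Fin 4 → ZMod N)
    (hper : ∀ x, ind Φ (x + (P : ZMod N)) = ind Φ x) (j : Fin 4)
    (hd : stdAddChar (((g * k' : ℕ) : ZMod N) * (gA 0 - gA j)) = -1) :
    rmul Φ (Multiplicative.ofAdd (gA j)) =
      Multiplicative.ofAdd (m : ZMod N) • rmul Φ (Multiplicative.ofAdd (gA 0)) :=
  conj_pair_of_shift hN Φ gA 0 j (shift_eq_of_char_dvd hN hgm hP hP2 hg hk' (ind Φ) hper _ hd)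

omit [NeZero N] in
/-- The indicator takes the values `0` and `1`. -/
theorem ind_zero_or_one (Φ : Finset (Multiplicative (ZMod N))) (x : ZMod N) : ind Φ x = 0 ∨ ind Φ x = 1 := by
  unfold ind; split_ifs <;> simp

/-- A constant indicator contradicts the CM condition. -/
theorem not_const_of_isCMType {m : ℕ} (Φ : Finset (Multiplicative (ZMod N)))
    (hΦ : IsCMType (Multiplicative.ofAdd (m : ZMod N)) Φ) (hconst : ∀ x, ind Φ (x + 1) = ind Φ x) : False := by
  have hc' : ∀ n : ℕ, ind Φ (n : ZMod N) = ind Φ 0 := by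
    intro n
    induction n with
    | zero => rw [Nat.cast_zero]
    | succ n ih => rw [Nat.cast_succ, hconst, ih]
  have hc : ∀ x : ZMod N, ind Φ x = ind Φ 0 := fun x => by
    rw [← ZMod.natCast_zmod_val x, hc' x.val]
  have h1 := ind_add_half Φ hΦ 0
  rw [hc ((0 : ZMod N) + (m : ZMod N))] at h1
  unfold ind at h1
  split_ifs at h1 <;> norm_num at h1

/-- **Support.**  `N = 2pq`: without a conjugate pair, `𝓕(1_Φ)` is supported on `{k : 2q k = 0} ∪ {k : 2p k = 0}`. -/
theorem support {p q m : ℕ} (hp : p.Prime) (hq : q.Prime) (hm : m = p * q)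
    (hN : N = 2 * m) (Φ : Finset (Multiplicative (ZMod N)))
    (hΦ : IsCMType (Multiplicative.ofAdd (m : ZMod N)) Φ) (gA : Fin 4 → ZMod N)
    (hs : SumTwo (fun i => rmul Φ (Multiplicative.ofAdd (gA i))))
    (hnc : ∀ i j : Fin 4, rmul Φ (Multiplicative.ofAdd (gA j)) ≠
      Multiplicative.ofAdd (m : ZMod N) • rmul Φ (Multiplicative.ofAdd (gA i)))
    (k : ZMod N) (hk : ZMod.dft (ind Φ) k ≠ 0) :
    ((2 * q : ℕ) : ZMod N) * k = 0 ∨ ((2 * p : ℕ) : ZMod N) * k = 0 := by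
  have hN0 := natCast_two_mul_eq_zero hN
  by_cases hk0 : k = 0
  · left; rw [hk0, mul_zero]
  -- `k` is odd
  have hkodd : Odd k.val := by
    by_contra hev
    rw [Nat.not_odd_iff_even] at hev
    obtain ⟨r, hr⟩ := hev
    apply hk
    apply dft_ind_eq_zero_of_even Φ hΦ k hk0
    rw [← ZMod.natCast_zmod_val k, hr, ← Nat.cast_mul, show m * (r + r) = (2 * m) * r by ring, Nat.cast_mul,
      hN0, zero_mul, map_zero_eq_one]
  by_cases hpk : p ∣ k.val
  · left
    obtain ⟨r, hr⟩ := hpk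
    rw [← ZMod.natCast_zmod_val k, hr, ← Nat.cast_mul, show 2 * q * (p * r) = (2 * m) * r by rw [hm]; ring,
      Nat.cast_mul, hN0, zero_mul]
  by_cases hqk : q ∣ k.val
  · right
    obtain ⟨r, hr⟩ := hqk
    rw [← ZMod.natCast_zmod_val k, hr, ← Nat.cast_mul, show 2 * p * (q * r) = (2 * m) * r by rw [hm]; ring,
      Nat.cast_mul, hN0, zero_mul]
  -- `k` coprime to `N`: a vanishing character sum would give a conjugate pair
  exfalso
  have hcop : Nat.Coprime k.val N := by
    have h' : Nat.Coprime k.val (2 * (p * q)) :=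
      Nat.Coprime.mul_right (Nat.coprime_two_right.mpr hkodd)
        (Nat.Coprime.mul_right (Nat.coprime_comm.mp ((Nat.Prime.coprime_iff_not_dvd hp).mpr hpk))
          (Nat.coprime_comm.mp ((Nat.Prime.coprime_iff_not_dvd hq).mpr hqk)))
    have e : 2 * (p * q) = N := by rw [hN, hm]
    rw [e] at h'
    exact h'
  have hsum : ∑ i : Fin 4, stdAddChar (-(gA i * k)) = 0 :=
    (mul_eq_zero.mp (char_sum_mul_dft Φ gA hs k hk0)).resolve_right hk
  obtain ⟨j, hj⟩ := exists_char_eq_neg_one gA k hsum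
  refine hnc 0 j (conj_of_char 1 N k.val hN (one_dvd m) (one_mul N).symm (by rw [hN]; exact dvd_mul_right 2 m)
    odd_one hcop Φ gA (fun x => by rw [ZMod.natCast_self, add_zero]) j ?_)
  rw [Nat.one_mul, ZMod.natCast_zmod_val, mul_comm]; exact hj

/-- **Branch.**  `N = 2pq`, `f = 1_Φ` `2p`-periodic, no conjugate pair — impossible. -/
theorem branch {p q m : ℕ} (hp : p.Prime) (hq : q.Prime) (hp2 : p ≠ 2) (hq2 : q ≠ 2) (hm : m = p * q)
    (hN : N = 2 * m) (Φ : Finset (Multiplicative (ZMod N)))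
    (hΦ : IsCMType (Multiplicative.ofAdd (m : ZMod N)) Φ) (gA : Fin 4 → ZMod N)
    (hs : SumTwo (fun i => rmul Φ (Multiplicative.ofAdd (gA i))))
    (hnc : ∀ i j : Fin 4, rmul Φ (Multiplicative.ofAdd (gA j)) ≠
      Multiplicative.ofAdd (m : ZMod N) • rmul Φ (Multiplicative.ofAdd (gA i)))
    (hper : ∀ x, ind Φ (x + ((2 * p : ℕ) : ZMod N)) = ind Φ x) : False := by
  have hpodd : Odd p := hp.odd_of_ne_two hp2
  have hqodd : Odd q := hq.odd_of_ne_two hq2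
  have hmodd : Odd m := hm ▸ hpodd.mul hqodd
  have hp0 : 0 < p := hp.pos
  have hq0 : 0 < q := hq.pos
  have hN0 := natCast_two_mul_eq_zero hN
  have hNq : N = (2 * p) * q := by rw [hN, hm]; ring
  by_cases hE : ∃ j : Fin 4, stdAddChar (((q * 1 : ℕ) : ZMod N) * (gA 0 - gA j)) = -1
  · obtain ⟨j, hj⟩ := hE
    exact hnc 0 j (conj_of_char q (2 * p) 1 hN (hm ▸ dvd_mul_left q p) (by rw [hN, hm]; ring)
      (dvd_mul_right 2 p) hqodd (Nat.coprime_one_left _) Φ gA hper j hj)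
  -- the support is `{0, m}`
  have hsupp2 : ∀ k, ZMod.dft (ind Φ) k ≠ 0 → k = 0 ∨ k = (m : ZMod N) := by
    intro k hk
    by_cases hk0 : k = 0
    · exact Or.inl hk0
    right
    have h2p : ((2 * p : ℕ) : ZMod N) * k = 0 := mul_eq_zero_of_dft_ne_zero_of_periodic (ind Φ) _ hper k hk
    obtain ⟨k'', hk''⟩ := dvd_val_of_mul_eq_zero hNq (by omega) k h2p
    have hkodd : Odd k.val := by
      by_contra hev
      rw [Nat.not_odd_iff_even] at hev
      obtain ⟨r, hr⟩ := hev
      apply hk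
      apply dft_ind_eq_zero_of_even Φ hΦ k hk0
      rw [← ZMod.natCast_zmod_val k, hr, ← Nat.cast_mul, show m * (r + r) = (2 * m) * r by ring,
        Nat.cast_mul, hN0, zero_mul, map_zero_eq_one]
    have hk''odd : Odd k'' := by
      have : Odd (q * k'') := by rw [← hk'']; exact hkodd
      exact (Nat.odd_mul.mp this).2
    by_cases hpk : p ∣ k''
    · -- `k.val = q p s` with `0 < s < 2`
      obtain ⟨s, hs'⟩ := hpk
      have hval : k.val = m * s := by rw [hk'', hs', hm]; ring
      have hlt : k.val < N := ZMod.val_lt k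
      have hne : k.val ≠ 0 := fun h => hk0 ((ZMod.val_eq_zero k).mp h)
      have hs1 : s = 1 := by
        rw [hval, hN] at hlt
        have hm0 : 0 < m := by rw [hm]; exact Nat.mul_pos hp0 hq0
        have : s < 2 := by
          rcases Nat.lt_or_ge s 2 with h | h
          · exact h
          · exact absurd hlt (not_lt.mpr (by linarith [Nat.mul_le_mul_left m h]))
        rcases s with _ | _ | s
        · exact absurd (by rw [hval]; ring) hne
        · rfl
        · omega
      rw [← ZMod.natCast_zmod_val k, hval, hs1, Nat.mul_one]
    · exfalso
      have hcop : Nat.Coprime k'' (2 * p) :=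
        Nat.Coprime.mul_right (Nat.coprime_two_right.mpr hk''odd)
          (Nat.coprime_comm.mp ((Nat.Prime.coprime_iff_not_dvd hp).mpr hpk))
      have hsum : ∑ i : Fin 4, stdAddChar (-(gA i * k)) = 0 :=
        (mul_eq_zero.mp (char_sum_mul_dft Φ gA hs k hk0)).resolve_right hk
      obtain ⟨j, hj⟩ := exists_char_eq_neg_one gA k hsum
      apply hE
      refine ⟨j, ?_⟩
      -- `ψ(q k'' d) = -1` with `k''` coprime to `2p` forces `ψ(q d) = -1`
      have hd : stdAddChar (((q * k'' : ℕ) : ZMod N) * (gA 0 - gA j)) = -1 := by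
        rw [← hk'', ZMod.natCast_zmod_val, mul_comm]; exact hj
      have hzk : (stdAddChar ((q : ZMod N) * (gA 0 - gA j))) ^ k'' = -1 := by
        rw [← map_nsmul_eq_pow, nsmul_eq_mul, ← hd]
        congr 1; push_cast; ring
      have hzP : (stdAddChar ((q : ZMod N) * (gA 0 - gA j))) ^ (2 * p) = 1 := by
        rw [← map_nsmul_eq_pow, nsmul_eq_mul, ← mul_assoc, ← Nat.cast_mul, ← hNq,
          ZMod.natCast_self, zero_mul, map_zero_eq_one]
      have := eq_neg_one_of_pow_eq_neg_one hzP (dvd_mul_right 2 p) hcop hzk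
      rwa [Nat.mul_one]
  -- `f` is `2`-periodic
  have h2per : ∀ x, ind Φ (x + ((2 : ℕ) : ZMod N)) = ind Φ x := by
    apply periodic_of_dft
    intro k hk
    rcases hsupp2 k hk with rfl | rfl
    · rw [mul_zero, map_zero_eq_one]
    · rw [← Nat.cast_mul, hN0, map_zero_eq_one]
  -- `𝓕f(m) ≠ 0`, else `f` is constant
  have hm_ne : ZMod.dft (ind Φ) (m : ZMod N) ≠ 0 := by
    intro h0
    apply not_const_of_isCMType Φ hΦ
    apply periodic_of_dft
    intro k hk
    rcases hsupp2 k hk with rfl | rfl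
    · rw [mul_zero, map_zero_eq_one]
    · exact absurd h0 hk
  have hm0 : (m : ZMod N) ≠ 0 := natCast_half_ne_zero hN
  have hsum : ∑ i : Fin 4, stdAddChar (-(gA i * (m : ZMod N))) = 0 :=
    (mul_eq_zero.mp (char_sum_mul_dft Φ gA hs _ hm0)).resolve_right hm_ne
  obtain ⟨j, hj⟩ := exists_char_eq_neg_one gA (m : ZMod N) hsum
  refine hnc 0 j (conj_of_char m 2 1 hN dvd_rfl (by rw [hN]; ring) dvd_rfl hmodd (Nat.coprime_one_left _) Φ gA
    h2per j ?_)
  rw [Nat.mul_one, mul_comm]; exact hj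

/-- **Main theorem.**  On the cyclic group of order `N = 2pq` (`p ≠ q` odd primes) with involution `c = pq`, every
`SumTwo` quadruple of Galois twists of a CM type has two complex-conjugate corners. -/
theorem exists_conj_of_sumTwo_cyclic_two_primes {p q : ℕ} (hp : p.Prime) (hq : q.Prime) (hp2 : p ≠ 2)
    (hq2 : q ≠ 2) (hpq : p ≠ q) (hN : N = 2 * (p * q)) (Φ : Finset (Multiplicative (ZMod N)))
    (hΦ : IsCMType (Multiplicative.ofAdd ((p * q : ℕ) : ZMod N)) Φ)
    (g : Fin 4 → Multiplicative (ZMod N)) (hs : SumTwo (fun i => rmul Φ (g i))) :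
    ∃ i j : Fin 4, rmul Φ (g j) = Multiplicative.ofAdd ((p * q : ℕ) : ZMod N) • rmul Φ (g i) := by
  by_contra hnc'
  have hnc : ∀ i j : Fin 4, rmul Φ (g j) ≠
      Multiplicative.ofAdd ((p * q : ℕ) : ZMod N) • rmul Φ (g i) :=
    fun i j h => hnc' ⟨i, j, h⟩
  obtain ⟨gA, hgA⟩ : ∃ gA : Fin 4 → ZMod N, ∀ i, g i = Multiplicative.ofAdd (gA i) :=
    ⟨fun i => Multiplicative.toAdd (g i), fun i => rfl⟩
  simp only [hgA] at hs hnc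
  obtain ⟨m, hm⟩ : ∃ m : ℕ, m = p * q := ⟨_, rfl⟩
  rw [← hm] at hΦ hnc hN
  have hcop : Nat.Coprime p q := (Nat.coprime_primes hp hq).mpr hpq
  have hodd : Odd (p * q) := (hp.odd_of_ne_two hp2).mul (hq.odd_of_ne_two hq2)
  have hp0 : 0 < p := hp.pos
  have hq0 : 0 < q := hq.pos
  have hNp : N = p * (2 * q) := by rw [hN, hm]; ring
  have hNq : N = q * (2 * p) := by rw [hN, hm]; ring
  have hsupp := support hp hq hm hN Φ hΦ gA hs hnc
  have hanti : ∀ x, ind Φ (x + ((p * q : ℕ) : ZMod N)) = 1 - ind Φ x := by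
    intro x; rw [← hm]; exact ind_add_half Φ hΦ x
  rcases periodic_dichotomy (hm ▸ hN) hcop hodd hp0 hq0 (ind Φ) (ind_zero_or_one Φ) hanti
      (fun x y x' y' hx hy hxy hxy' => rect hNp hNq hp0 hq0 (ind Φ) hsupp hx hy hxy hxy') with h2p | h2q
  · -- `2p`-periodic
    apply branch hp hq hp2 hq2 hm hN Φ hΦ gA hs hnc
    intro x
    apply h2p
    rw [add_sub_cancel_left, ← Nat.cast_mul, ← hNq, ZMod.natCast_self]
  · -- `2q`-periodic: the same with `p ↔ q`
    apply branch hq hp hq2 hp2 (hm.trans (mul_comm p q)) hN Φ hΦ gA hs hnc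
    intro x
    apply h2q
    rw [add_sub_cancel_left, ← Nat.cast_mul, ← hNp, ZMod.natCast_self]

/-- **Corollary in the `QuadFinset12` shape.** -/
theorem not_isSingleClass_cyclic_two_primes {p q : ℕ} (hp : p.Prime) (hq : q.Prime) (hp2 : p ≠ 2)
    (hq2 : q ≠ 2) (hpq : p ≠ q) (hN : N = 2 * (p * q)) (T : Fin 4 → Finset (Multiplicative (ZMod N)))
    (hT : IsCMType (Multiplicative.ofAdd ((p * q : ℕ) : ZMod N)) (T 0)) (hs : SumTwo T)
    (hnc : ∀ i j : Fin 4, T j ≠ Multiplicative.ofAdd ((p * q : ℕ) : ZMod N) • T i) :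
    ¬ IsSingleClass T := by
  intro hsc
  choose g hg using hsc
  have hT' : T = fun i => rmul (T 0) (g i) := funext hg
  have hs' : SumTwo (fun i => rmul (T 0) (g i)) := by rw [← hT']; exact hs
  obtain ⟨i, j, hij⟩ := exists_conj_of_sumTwo_cyclic_two_primes hp hq hp2 hq2 hpq hN (T 0) hT g hs'
  exact hnc i j (by rw [hg j, hg i]; exact hij)

/-! ### Instances: `C₃₀, C₄₂, C₆₆, C₇₀, C₇₈` -/

/-- The cyclic group of order `30`. -/
abbrev C30 := Multiplicative (ZMod 30)

/-- Its involution `15 = 3 · 5`. -/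
def cc_C30 : C30 := Multiplicative.ofAdd ((3 * 5 : ℕ) : ZMod 30)

/-- `C₃₀` (the first cyclic order not covered by the one-prime theorem; empty by the census): no single-class
`SumTwo` quadruple without a conjugate pair. -/
theorem not_isSingleClass_C30_cyclic (T : Fin 4 → Finset C30) (hT : IsCMType cc_C30 (T 0)) (hs : SumTwo T)
    (hnc : ∀ i j : Fin 4, T j ≠ cc_C30 • T i) : ¬ IsSingleClass T :=
  not_isSingleClass_cyclic_two_primes Nat.prime_three Nat.prime_five (by norm_num) (by norm_num) (by norm_num)
    (by norm_num) T hT hs hnc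

/-- The cyclic group of order `42`. -/
abbrev C42 := Multiplicative (ZMod 42)

/-- Its involution `21 = 3 · 7`. -/
def cc_C42 : C42 := Multiplicative.ofAdd ((3 * 7 : ℕ) : ZMod 42)

/-- `C₄₂`: no single-class `SumTwo` quadruple without a conjugate pair. -/
theorem not_isSingleClass_C42_cyclic (T : Fin 4 → Finset C42) (hT : IsCMType cc_C42 (T 0)) (hs : SumTwo T)
    (hnc : ∀ i j : Fin 4, T j ≠ cc_C42 • T i) : ¬ IsSingleClass T :=
  not_isSingleClass_cyclic_two_primes Nat.prime_three (by norm_num) (by norm_num) (by norm_num) (by norm_num)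
    (by norm_num) T hT hs hnc

/-- The cyclic group of order `66`. -/
abbrev C66 := Multiplicative (ZMod 66)

/-- Its involution `33 = 3 · 11`. -/
def cc_C66 : C66 := Multiplicative.ofAdd ((3 * 11 : ℕ) : ZMod 66)

/-- `C₆₆`: no single-class `SumTwo` quadruple without a conjugate pair. -/
theorem not_isSingleClass_C66_cyclic (T : Fin 4 → Finset C66) (hT : IsCMType cc_C66 (T 0)) (hs : SumTwo T)
    (hnc : ∀ i j : Fin 4, T j ≠ cc_C66 • T i) : ¬ IsSingleClass T :=
  not_isSingleClass_cyclic_two_primes Nat.prime_three (by norm_num) (by norm_num) (by norm_num) (by norm_num)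
    (by norm_num) T hT hs hnc

/-- The cyclic group of order `70`. -/
abbrev C70 := Multiplicative (ZMod 70)

/-- Its involution `35 = 5 · 7`. -/
def cc_C70 : C70 := Multiplicative.ofAdd ((5 * 7 : ℕ) : ZMod 70)

/-- `C₇₀`: no single-class `SumTwo` quadruple without a conjugate pair. -/
theorem not_isSingleClass_C70_cyclic (T : Fin 4 → Finset C70) (hT : IsCMType cc_C70 (T 0)) (hs : SumTwo T)
    (hnc : ∀ i j : Fin 4, T j ≠ cc_C70 • T i) : ¬ IsSingleClass T :=
  not_isSingleClass_cyclic_two_primes Nat.prime_five (by norm_num) (by norm_num) (by norm_num) (by norm_num)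
    (by norm_num) T hT hs hnc

/-- The cyclic group of order `78`. -/
abbrev C78 := Multiplicative (ZMod 78)

/-- Its involution `39 = 3 · 13`. -/
def cc_C78 : C78 := Multiplicative.ofAdd ((3 * 13 : ℕ) : ZMod 78)

/-- `C₇₈`: no single-class `SumTwo` quadruple without a conjugate pair. -/
theorem not_isSingleClass_C78_cyclic (T : Fin 4 → Finset C78) (hT : IsCMType cc_C78 (T 0)) (hs : SumTwo T)
    (hnc : ∀ i j : Fin 4, T j ≠ cc_C78 • T i) : ¬ IsSingleClass T :=
  not_isSingleClass_cyclic_two_primes Nat.prime_three (by norm_num) (by norm_num) (by norm_num) (by norm_num)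
    (by norm_num) T hT hs hnc

end HodgeRepro.CyclicQuad
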